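import Literature.AlgebraicGeometry.Resolution.KedlayaEtaleCoversAlgebra
import Literature.NumberTheory.Transcendental.DerivationExtension
import Mathlib.RingTheory.LocalRing.Module
import Mathlib.RingTheory.TensorProduct.Free
import HarnessLib

/-!
# [OURS · L1 W8.2] THE DIFFERENTIAL (1-FORM) CRITERION OF SMOOTHNESS: for `k → K → B` with `B` formally smooth
# over `k`, `B` is formally smooth over `K` iff `B ⊗_K Ω_{K/k} → Ω_{B/k}` is split injective; for `B` local, iff it
# is injective after `⊗ κ(B)`, i.e. iff the 1-forms `dt_i` of a basis of `Ω_{K/k}` stay linearly independent at the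
# closed point

Cell `res-hironaka` (run/shared/lean/pub/res-hironaka/), LADDER-RESOLUTION rung L (RESCUE), slot W8.2; host route
`UniversalCells`, host item `PrimeFieldToPerfect` (stmt-ResolutionOfSingularities-15233), door 1. Proofs file
(Theses-free), written by res-L1-s82-pv-1 (gen 7). This is form (E6) of Cruxes/PrimeFieldToPerfect/KERNEL.md §2
(«1-form form: for a regular model `Y` …, `Y` smooth/`K` ⟺ `dt_1 ∧ … ∧ dt_r` is nowhere zero on `Y` in `Ω^r_{Y/𝔽_p}`»),
the last untyped entry of that list, kernel-checked here in its commutative-algebra form for an ARBITRARY tower of rings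
`k → K → B`:

* `formallySmooth_iff_injective_mapBaseChange_and_projective` — if `B` is formally smooth over `k`, then `B` is formally
  smooth over `K` iff the base-changed differential map `B ⊗_K Ω_{K/k} → Ω_{B/k}` (Mathlib
  `KaehlerDifferential.mapBaseChange k K B`) is INJECTIVE and `Ω_{B/K}` is projective (Jacobi–Zariski:
  `H₁(L_{B/k}) → H₁(L_{B/K}) → B ⊗_K Ω_{K/k} → Ω_{B/k} → Ω_{B/K} → 0`; Mathlib's `Algebra.FormallySmooth` IS
  «`Ω` projective and `H₁ = 0`»).
* `formallySmooth_iff_exists_retraction_mapBaseChange` — … iff `B ⊗_K Ω_{K/k} → Ω_{B/k}` is SPLIT injective (has a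
  `B`-linear retraction): EGA 0_IV 20.5.7 (ii) / Matsumura 25.1 in Mathlib's vocabulary.
* `formallySmooth_iff_injective_lTensor_residueField_mapBaseChange` — `B` LOCAL with residue field `κ`, `Ω_{B/k}` and
  `Ω_{K/k}` finitely generated: … iff `κ ⊗_B (B ⊗_K Ω_{K/k}) → κ ⊗_B Ω_{B/k}` is injective (a map into a finite free
  module over a local ring is split injective iff it is injective modulo the maximal ideal, Mathlib
  `IsLocalRing.split_injective_iff_lTensor_residueField_injective`).
* `formallySmooth_iff_linearIndependent_residueField` — … iff for a (any) `K`-basis `(ω_i)` of `Ω_{K/k}` the classes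
  `1 ⊗ ω_i|_B` are `κ`-linearly independent in `κ ⊗_B Ω_{B/k}`; `formallySmooth_iff_linearIndependent_D` — the same
  for `ω_i = dt_i` (`t_i ∈ K` whose differentials form a basis, e.g. a separating transcendence basis / a `p`-basis);
  `formallySmooth_iff_tmul_D_ne_zero` — ONE generator `t` (`Ω_{K/k} = K dt`): `B` is formally smooth over `K` iff
  `1 ⊗ d(t) ≠ 0` in `κ ⊗_B Ω_{B/k}` — «the 1-form `dt` does not vanish at the closed point».

The slot's reading (`k = M` perfect, `K = M(t)`, `B = 𝒪_{Y,y}` a regular local ring essentially of finite type over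
`M(t)`, where «regular» ⟺ «formally smooth over `M`») is the companion file `…DifferentialCriterionRatFunc`: a regular
`Y` locally of finite type over `M(t)` is smooth over `M(t)` at `y` iff `dt(y) ≠ 0`; the W8.2 residual asks for a
resolution of some Frobenius twist `X₀^{(p^e)}` on which the 1-form `dt` vanishes NOWHERE.

HONEST FRAMING. OURS theorems (classical commutative algebra assembled from Mathlib's Jacobi–Zariski sequence and the
tree: EGA 0_IV 20.5.7 (ii), Matsumura 25.1); they replace the role of no printed item of [Hironaka2017] and are NOT
statements of the manuscript; nothing is attributed to its author. A normal form, not progress on the open residual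
(`PerfectionStepAt M n`, `n ≥ 4`). AI work, weaker than expert review; no claim beyond the kernel. No `sorry`, no new
axioms.

## References (locators only)
* A. Grothendieck, *EGA 0_IV* (Publ. Math. IHÉS 20, 1964), Thm. 20.5.7 (ii), Cor. 20.5.8.
* H. Matsumura, *Commutative Ring Theory* (1986), Thm. 25.1 (first fundamental exact sequence). [Matsumura1987]
* The Stacks Project, Tags 00S2 (Jacobi–Zariski), 031J (formal smoothness via `NL`). [StacksProject]
-/

noncomputable section

set_option linter.dupNamespace false -- mandated namespace of this single-conjunct summit

open IsLocalRing TensorProduct KaehlerDifferential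
open Literature.AlgebraicGeometry.Resolution

namespace Summit.ResolutionOfSingularities.ResolutionOfSingularities.Theorems.CampaignW82

universe u

/-! ## §1 Any tower `k → K → B` with `B` formally smooth over `k` -/

section AnyRings

variable (k K B : Type u) [CommRing k] [CommRing K] [CommRing B] [Algebra k K] [Algebra k B] [Algebra K B]
  [IsScalarTower k K B]

/-- **The differential criterion of formal smoothness in a tower** (`k → K → B`, `B` formally smooth over `k`):
`B` is formally smooth over `K` iff `B ⊗_K Ω_{K/k} → Ω_{B/k}` is injective and `Ω_{B/K}` is a projective
`B`-module. (⇒: Jacobi–Zariski, the kernel is the image of `H₁(L_{B/K}) = 0`; ⇐: `H₁(L_{B/k}) = 0` and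
injectivity force `H₁(L_{B/K}) = 0`.) [cite: EGA0IV, Thm. 20.5.7] -/
theorem formallySmooth_iff_injective_mapBaseChange_and_projective [Algebra.FormallySmooth k B] :
    Algebra.FormallySmooth K B ↔
      Function.Injective (KaehlerDifferential.mapBaseChange k K B) ∧ Module.Projective B Ω[B⁄K] := by
  constructor
  · intro h
    exact ⟨Literature.NumberTheory.Transcendental.mapBaseChange_injective_of_formallySmooth k K B,
      inferInstance⟩
  · rintro ⟨hinj, hproj⟩
    haveI := Kedlaya2004.subsingleton_h1Cotangent_of_injective_mapBaseChange k K B hinj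
    exact ⟨hproj, inferInstance⟩

/-- In the tower `k → K → B` the cokernel of `B ⊗_K Ω_{K/k} → Ω_{B/k}` is `Ω_{B/K}`: if the former map has a
retraction then `Ω_{B/k} → Ω_{B/K}` has a section (splitting lemma), so `Ω_{B/K}` is a direct summand of
`Ω_{B/k}`. [cite: Matsumura1987, Thm. 25.1] -/
theorem exists_section_map_of_exists_retraction_mapBaseChange
    (h : ∃ r : Ω[B⁄k] →ₗ[B] B ⊗[K] Ω[K⁄k], r ∘ₗ KaehlerDifferential.mapBaseChange k K B = LinearMap.id) :
    ∃ s : Ω[B⁄K] →ₗ[B] Ω[B⁄k], KaehlerDifferential.map k K B B ∘ₗ s = LinearMap.id := by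
  obtain ⟨r, hr⟩ := h
  have hinj : Function.Injective (KaehlerDifferential.mapBaseChange k K B) :=
    Function.HasLeftInverse.injective ⟨r, fun x => congrArg (fun φ => φ x) hr⟩
  have htfae := (Function.Exact.split_tfae (KaehlerDifferential.exact_mapBaseChange_map k K B) hinj
    (KaehlerDifferential.map_surjective k K B)).out 0 1
  exact htfae.mpr ⟨r, hr⟩

/-- **EGA 0_IV 20.5.7 (ii) / Matsumura 25.1 in Mathlib's vocabulary**: for `k → K → B` with `B` formally smooth over
`k`, `B` is formally smooth over `K` iff `B ⊗_K Ω_{K/k} → Ω_{B/k}` is SPLIT injective, i.e. has a `B`-linear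
retraction (then `0 → B ⊗_K Ω_{K/k} → Ω_{B/k} → Ω_{B/K} → 0` is split exact). [cite: EGA0IV, Thm. 20.5.7] -/
theorem formallySmooth_iff_exists_retraction_mapBaseChange [Algebra.FormallySmooth k B] :
    Algebra.FormallySmooth K B ↔
      ∃ r : Ω[B⁄k] →ₗ[B] B ⊗[K] Ω[K⁄k], r ∘ₗ KaehlerDifferential.mapBaseChange k K B = LinearMap.id := by
  rw [formallySmooth_iff_injective_mapBaseChange_and_projective k K B]
  constructor
  · rintro ⟨hinj, hproj⟩
    -- `Ω_{B/k} → Ω_{B/K}` splits since `Ω_{B/K}` is projective; the splitting lemma gives the retraction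
    haveI := hproj
    have htfae := (Function.Exact.split_tfae (KaehlerDifferential.exact_mapBaseChange_map k K B) hinj
      (KaehlerDifferential.map_surjective k K B)).out 0 1
    refine htfae.mp ?_
    exact Module.projective_lifting_property (KaehlerDifferential.map k K B B) LinearMap.id
      (KaehlerDifferential.map_surjective k K B)
  · intro h
    obtain ⟨r, hr⟩ := h
    have hinj : Function.Injective (KaehlerDifferential.mapBaseChange k K B) :=
      Function.HasLeftInverse.injective ⟨r, fun x => congrArg (fun φ => φ x) hr⟩
    refine ⟨hinj, ?_⟩
    -- `Ω_{B/K}` is a direct summand of the projective `Ω_{B/k}`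
    obtain ⟨s, hs⟩ := exists_section_map_of_exists_retraction_mapBaseChange k K B ⟨r, hr⟩
    exact Module.Projective.of_split s (KaehlerDifferential.map k K B B) hs

end AnyRings

/-! ## §2 Local rings: the criterion at the closed point -/

section LocalRing

variable (k K B : Type u) [CommRing k] [CommRing K] [CommRing B] [Algebra k K] [Algebra k B] [Algebra K B]
  [IsScalarTower k K B] [IsLocalRing B]

/-- **The differential criterion at the closed point** (`B` local with residue field `κ`, `B` formally smooth over
`k`, `Ω_{B/k}` a finitely generated `B`-module and `Ω_{K/k}` a finitely generated `K`-module): `B` is formally smooth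
over `K` iff `κ ⊗_B (B ⊗_K Ω_{K/k}) → κ ⊗_B Ω_{B/k}` is injective. (`Ω_{B/k}` is finite projective, hence free,
over the local ring `B`; a linear map from a finite module to a finite free module over a local ring is split
injective iff it is injective modulo the maximal ideal.) [cite: EGA0IV, Thm. 20.5.7] -/
theorem formallySmooth_iff_injective_lTensor_residueField_mapBaseChange [Algebra.FormallySmooth k B]
    [Module.Finite B Ω[B⁄k]] [Module.Finite K Ω[K⁄k]] :
    Algebra.FormallySmooth K B ↔
      Function.Injective ((KaehlerDifferential.mapBaseChange k K B).lTensor (ResidueField B)) := by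
  haveI : Module.Free B Ω[B⁄k] := Module.free_of_flat_of_isLocalRing
  haveI : Module.Finite B (B ⊗[K] Ω[K⁄k]) := inferInstance
  rw [formallySmooth_iff_exists_retraction_mapBaseChange k K B,
    IsLocalRing.split_injective_iff_lTensor_residueField_injective]

/-- Linear algebra: a linear map out of a module with a basis is injective iff it carries the basis to a linearly
independent family. [folklore] -/
theorem injective_iff_linearIndependent_comp_basis {R V W : Type*} [CommRing R] [AddCommGroup V] [Module R V]
    [AddCommGroup W] [Module R W] {ι : Type*} (b : Module.Basis ι R V) (g : V →ₗ[R] W) :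
    Function.Injective g ↔ LinearIndependent R (g ∘ b) := by
  rw [linearIndependent_iff_injective_finsuppLinearCombination, Finsupp.linearCombination_linear_comp,
    ← Module.Basis.coe_repr_symm]
  change _ ↔ Function.Injective (g ∘ (b.repr.symm : (ι →₀ R) →ₗ[R] V))
  exact (Function.Injective.of_comp_iff' g b.repr.symm.bijective).symm

variable {ι : Type*}

/-- **The 1-form criterion** (`B` local, residue field `κ`, formally smooth over `k`, `Ω_{B/k}` finite; `(ω_i)` a
`K`-basis of `Ω_{K/k}`): `B` is formally smooth over `K` iff the classes `1 ⊗ ω_i|_B ∈ κ ⊗_B Ω_{B/k}` are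
`κ`-linearly independent — the pulled-back 1-forms `ω_i` stay independent AT THE CLOSED POINT.
[cite: EGA0IV, Thm. 20.5.7] -/
theorem formallySmooth_iff_linearIndependent_residueField [Algebra.FormallySmooth k B] [Module.Finite B Ω[B⁄k]]
    (b : Module.Basis ι K Ω[K⁄k]) [Finite ι] :
    Algebra.FormallySmooth K B ↔
      LinearIndependent (ResidueField B)
        (fun i => (1 : ResidueField B) ⊗ₜ[B] KaehlerDifferential.mapBaseChange k K B ((1 : B) ⊗ₜ[K] b i)) := by
  haveI : Module.Finite K Ω[K⁄k] := Module.Finite.of_basis b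
  rw [formallySmooth_iff_injective_lTensor_residueField_mapBaseChange k K B]
  set f := KaehlerDifferential.mapBaseChange k K B with hf
  let κ := ResidueField B
  -- `κ ⊗_B (B ⊗_K Ω_{K/k}) ≃ κ ⊗_K Ω_{K/k}`, with `κ`-basis `1 ⊗ ω_i`
  let e : κ ⊗[B] (B ⊗[K] Ω[K⁄k]) ≃ₗ[κ] κ ⊗[K] Ω[K⁄k] :=
    TensorProduct.AlgebraTensorModule.cancelBaseChange K B κ κ Ω[K⁄k]
  let g : κ ⊗[K] Ω[K⁄k] →ₗ[κ] κ ⊗[B] Ω[B⁄k] := f.baseChange κ ∘ₗ e.symm.toLinearMap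
  have hfg : Function.Injective (f.lTensor κ) ↔ Function.Injective g := by
    rw [← LinearMap.baseChange_eq_ltensor]
    change Function.Injective (f.baseChange κ) ↔ Function.Injective (f.baseChange κ ∘ e.symm)
    exact (Function.Injective.of_comp_iff' _ e.symm.bijective).symm
  rw [hfg, injective_iff_linearIndependent_comp_basis (Algebra.TensorProduct.basis κ b) g]
  have hfam : (⇑g ∘ ⇑(Algebra.TensorProduct.basis κ b)) =
      fun i => (1 : ResidueField B) ⊗ₜ[B] f ((1 : B) ⊗ₜ[K] b i) := by
    funext i
    change f.baseChange κ (e.symm (Algebra.TensorProduct.basis κ b i)) = _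
    rw [Algebra.TensorProduct.basis_apply, TensorProduct.AlgebraTensorModule.cancelBaseChange_symm_tmul,
      LinearMap.baseChange_tmul]
  rw [hfam]

/-- **The 1-form criterion, coordinates**: with `t_i ∈ K` whose differentials `dt_i` form a `K`-basis of `Ω_{K/k}`
(e.g. a separating transcendence basis of a separably generated field extension, or a `p`-basis), `B` is formally
smooth over `K` iff the `dt_i` (differentials in `Ω_{B/k}` of the images of the `t_i`) are linearly independent in
`κ ⊗_B Ω_{B/k}`. [cite: EGA0IV, Thm. 20.5.7] -/
theorem formallySmooth_iff_linearIndependent_D [Algebra.FormallySmooth k B] [Module.Finite B Ω[B⁄k]]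
    (b : Module.Basis ι K Ω[K⁄k]) [Finite ι] (t : ι → K) (hb : ∀ i, b i = KaehlerDifferential.D k K (t i)) :
    Algebra.FormallySmooth K B ↔
      LinearIndependent (ResidueField B)
        (fun i => (1 : ResidueField B) ⊗ₜ[B] KaehlerDifferential.D k B (algebraMap K B (t i))) := by
  have hfam : (fun i => (1 : ResidueField B) ⊗ₜ[B] KaehlerDifferential.mapBaseChange k K B ((1 : B) ⊗ₜ[K] b i)) =
      fun i => (1 : ResidueField B) ⊗ₜ[B] KaehlerDifferential.D k B (algebraMap K B (t i)) := by
    funext i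
    rw [hb i, KaehlerDifferential.mapBaseChange_tmul, one_smul, KaehlerDifferential.map_D]
  rw [formallySmooth_iff_linearIndependent_residueField k K B b, hfam]

/-- **The 1-form criterion, one generator** (`Ω_{K/k} = K·dt`, e.g. `K = M(t)` over `k = M`, or a field of
`p`-rank one with `p`-basis `{t}`): `B` is formally smooth over `K` iff `1 ⊗ dt ≠ 0` in `κ ⊗_B Ω_{B/k}` —
«the 1-form `dt` does not vanish at the closed point». [cite: EGA0IV, Thm. 20.5.7] -/
theorem formallySmooth_iff_tmul_D_ne_zero [Algebra.FormallySmooth k B] [Module.Finite B Ω[B⁄k]] [Unique ι]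
    (b : Module.Basis ι K Ω[K⁄k]) (t : K) (hb : b default = KaehlerDifferential.D k K t) :
    Algebra.FormallySmooth K B ↔
      (1 : ResidueField B) ⊗ₜ[B] KaehlerDifferential.D k B (algebraMap K B t) ≠ 0 := by
  rw [formallySmooth_iff_linearIndependent_D k K B b (fun _ => t) (fun i => by rw [Unique.eq_default i, hb]),
    linearIndependent_unique_iff]

end LocalRing

/-! ## §3 At a prime of an algebra (`Algebra.IsSmoothAt`) -/

section AtPrime

variable (k K A : Type u) [CommRing k] [CommRing K] [CommRing A] [Algebra k K] [Algebra k A] [Algebra K A]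
  [IsScalarTower k K A] (𝔭 : Ideal A) [𝔭.IsPrime] {ι : Type*}

/-- **The 1-form criterion at a prime** (`A` essentially of finite type over `k`, `k → K → A`, `𝔭 ⊂ A` prime with
`A` `k`-smooth at `𝔭`, `(ω_i)` a finite `K`-basis of `Ω_{K/k}`): `A` is `K`-smooth at `𝔭` (Mathlib
`Algebra.IsSmoothAt`: `A_𝔭` formally smooth over `K`) iff the 1-forms `ω_i` are linearly independent in
`κ(𝔭) ⊗ Ω_{A_𝔭/k}`. [cite: EGA0IV, Thm. 20.5.7] -/
theorem isSmoothAt_iff_linearIndependent_residueField [Algebra.EssFiniteType k A] [Algebra.IsSmoothAt k 𝔭]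
    (b : Module.Basis ι K Ω[K⁄k]) [Finite ι] :
    Algebra.IsSmoothAt K 𝔭 ↔
      LinearIndependent 𝔭.ResidueField
        (fun i => (1 : 𝔭.ResidueField) ⊗ₜ[Localization.AtPrime 𝔭]
          KaehlerDifferential.mapBaseChange k K (Localization.AtPrime 𝔭) ((1 : Localization.AtPrime 𝔭) ⊗ₜ[K] b i)) :=
  formallySmooth_iff_linearIndependent_residueField k K (Localization.AtPrime 𝔭) b

/-- **The 1-form criterion at a prime, one generator** (`Ω_{K/k} = K·dt`): `A` (essentially of finite type over `k`,
`k`-smooth at `𝔭`) is `K`-smooth at `𝔭` iff `1 ⊗ dt ≠ 0` in `κ(𝔭) ⊗ Ω_{A_𝔭/k}`. [cite: EGA0IV, Thm. 20.5.7] -/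
theorem isSmoothAt_iff_tmul_D_ne_zero [Algebra.EssFiniteType k A] [Algebra.IsSmoothAt k 𝔭] [Unique ι]
    (b : Module.Basis ι K Ω[K⁄k]) (t : K) (hb : b default = KaehlerDifferential.D k K t) :
    Algebra.IsSmoothAt K 𝔭 ↔
      (1 : 𝔭.ResidueField) ⊗ₜ[Localization.AtPrime 𝔭]
          KaehlerDifferential.D k (Localization.AtPrime 𝔭) (algebraMap K (Localization.AtPrime 𝔭) t) ≠ 0 :=
  formallySmooth_iff_tmul_D_ne_zero k K (Localization.AtPrime 𝔭) b t hb

end AtPrime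

end Summit.ResolutionOfSingularities.ResolutionOfSingularities.Theorems.CampaignW82
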